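import Summits.CriticalPhenomena.CardyFormulaZ2.Theorems.CardyBoundaryCoulombGasHalfPlaneMarkDensityLawBoxExhaustionPart3
import Literature.Probability.Percolation.RSWProofs

/-!
# Line `Sketch`, open stub C⁺ — a priori structure of the collinear half-plane crossing function, I:
# lattice moves of the arc endpoints (crux stmt-CriticalPhenomena-5661, lead c2-0)

The one open stub of line `Sketch` is C⁺, the collinear half-plane Cardy law for bond-`ℤ²`:
`P_n(a,b,c,y) := P_{1/2}[[⌊an⌋,⌊bn⌋]×{0} ↔ [⌊cn⌋,⌊yn⌋]×{0} in ℤ×ℕ] → F(η(a,b,c,y))`.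
This file proves, unconditionally, the lattice regularity of `P_n` in its four marks that every
identification argument for C⁺ starts from (Smirnov's scheme: precompactness + identification):

* §1 translated escape events have the probability of centred ones
  (`measureReal_escape_shift`), and a boundary interval joined to a far set forces an escape from a
  small box to outside a large box (`interval_crossing_subset_escape`), hence costs `≤ C (r/R)^α` by
  the tree's RSW one-arm power bound (hypothesis schema `hesc`, discharged by
  `exists_real_boxToFar_le_rpow_of_le_half`);
* §2 the lattice crossing function `Q(i,j,k,l) = P[[i,j]×{0} ↔ [k,l]×{0} in ℤ×ℕ]` is monotone in each
  endpoint and moving one endpoint by `≤ r` sites changes it by `≤ C (r/R)^α`, `R ≈` the gap `k − j`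
  (`le_move_l/k/j/i`), so a joint monotone move costs `≤ 4 C (m/R)^α` (`move_le`);
* the continuum corollaries for `P_n` (monotonicity, the `δ`-move bound, asymptotic translation
  invariance) are in the companion file `…Equicontinuity`.

Nothing here is specific to `p = 1/2` beyond the escape bound; no statement of the tree is restated.
-/

noncomputable section

namespace Summit.CriticalPhenomena.CardyFormulaZ2.Cruxes.HalfPlaneMarkDensityLaw.SketchLine

open Literature.Probability.Percolation Literature.Probability.LatticeModels
open MeasureTheory Filter Set
open scoped Topology
open Summit.CriticalPhenomena.CardyFormulaZ2.Theorems.HalfPlaneMarkDensityLaw.Negative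

namespace Subseq

/-! ## §1 Escape events: symmetry, translation, and the interval-to-far-set inclusion -/

/-- The escape event "some site of `Λ_r` is joined to a site outside `Λ_R`" is the crossing event of
the whole lattice between `Λ_r` and `Λ_Rᶜ`. [folklore] -/
theorem escape_eq_openCrossing (r R : ℕ) :
    {ω : BondConfig (Site 2) | ∃ x ∈ box 2 r, ∃ y ∉ box 2 R, ω ∈ openConnIn univ x y} =
      openCrossing univ (box 2 r : Set (Site 2)) ((box 2 R : Set (Site 2))ᶜ) := by
  ext ω
  simp only [mem_setOf_eq, mem_openCrossing_iff, Finset.mem_coe, mem_compl_iff]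

/-- Translation invariance of escape probabilities: the escape event around the site `u` has the
probability of the centred one (translation invariance of `P_{1/2}`, tree `real_openCrossing_shift`).
[folklore] -/
theorem measureReal_escape_shift (u : Site 2) (r R : ℕ) :
    μ.real (openCrossing univ ((· + u) '' (box 2 r : Set (Site 2)))
        ((· + u) '' ((box 2 R : Set (Site 2))ᶜ))) =
      μ.real {ω : BondConfig (Site 2) | ∃ x ∈ box 2 r, ∃ y ∉ box 2 R, ω ∈ openConnIn univ x y} := by
  rw [escape_eq_openCrossing]
  have hu : (· + u) '' (univ : Set (Site 2)) = univ :=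
    image_univ_of_surjective fun v ↦ ⟨v - u, by simp⟩
  have h := real_openCrossing_shift (d := 2) half u univ (box 2 r : Set (Site 2))
    ((box 2 R : Set (Site 2))ᶜ)
  rw [hu] at h
  exact h

/-- A boundary interval `[k₁,k₂]×{0}` of length `≤ r` lies in the box `Λ_r + (k₁,0)`. [folklore] -/
theorem rowIcc_subset_shift_box {k₁ k₂ : ℤ} {r : ℕ} (h : k₂ - k₁ ≤ r) :
    rowIcc k₁ k₂ ⊆ (· + (![k₁, 0] : Site 2)) '' (box 2 r : Set (Site 2)) := by
  rintro v ⟨hv1, hv0, hv0'⟩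
  refine ⟨v - ![k₁, 0], ?_, sub_add_cancel v _⟩
  rw [Finset.mem_coe, mem_box]
  intro i
  fin_cases i
  · simp only [Fin.zero_eta, Fin.isValue, Pi.sub_apply, Matrix.cons_val_zero]
    omega
  · simp only [Fin.mk_one, Fin.isValue, Pi.sub_apply, Matrix.cons_val_one, Matrix.cons_val_zero,
      hv1]
    omega

/-- A set of sites whose first coordinates avoid `[k₁ − R, k₁ + R]` misses the box `Λ_R + (k₁,0)`.
[folklore] -/
theorem subset_shift_box_compl {k₁ : ℤ} {R : ℕ} {T : Set (Site 2)}
    (hT : ∀ v ∈ T, v 0 + R < k₁ ∨ k₁ + R < v 0) :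
    T ⊆ (· + (![k₁, 0] : Site 2)) '' ((box 2 R : Set (Site 2))ᶜ) := by
  intro v hv
  refine ⟨v - ![k₁, 0], ?_, sub_add_cancel v _⟩
  rw [mem_compl_iff, Finset.mem_coe, mem_box, not_forall]
  refine ⟨0, fun h ↦ ?_⟩
  simp only [Fin.isValue, Pi.sub_apply, Matrix.cons_val_zero] at h
  rcases hT v hv with h' | h' <;> omega

/-- **Interval-to-far-set inclusion.** A crossing (inside any region) between a boundary interval
`[k₁,k₂]×{0}` of length `≤ r` and a set of sites at horizontal distance `> R` from `k₁` is an escape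
from `Λ_r + (k₁,0)` to outside `Λ_R + (k₁,0)`. [folklore] -/
theorem interval_crossing_subset_escape (S : Set (Site 2)) {k₁ k₂ : ℤ} {r R : ℕ} (h : k₂ - k₁ ≤ r)
    {T : Set (Site 2)} (hT : ∀ v ∈ T, v 0 + R < k₁ ∨ k₁ + R < v 0) :
    openCrossing S (rowIcc k₁ k₂) T ⊆
      openCrossing univ ((· + (![k₁, 0] : Site 2)) '' (box 2 r : Set (Site 2)))
        ((· + (![k₁, 0] : Site 2)) '' ((box 2 R : Set (Site 2))ᶜ)) :=
  openCrossing_mono (subset_univ _) (rowIcc_subset_shift_box h) (subset_shift_box_compl hT)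

section Escape

variable {C α : ℝ}
  (hesc : ∀ p : unitInterval, (p : ℝ) ≤ 1 / 2 → ∀ r R : ℕ, 1 ≤ r → r ≤ R →
    (bondPercolation (zdGraph 2) p).real
      {ω | ∃ x ∈ box 2 r, ∃ y ∉ box 2 R, ω ∈ openConnIn Set.univ x y} ≤ C * ((r : ℝ) / R) ^ α)
include hesc

/-- **Interval-to-far-set bound** (target far): `P[[k₁,k₂]×{0} ↔ T in S] ≤ C (r/R)^α` whenever the
interval has length `≤ r`, `1 ≤ r ≤ R`, and `T` is at horizontal distance `> R` from `k₁`. [folklore] -/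
theorem measureReal_interval_crossing_le (S : Set (Site 2)) {k₁ k₂ : ℤ} {r R : ℕ} (h : k₂ - k₁ ≤ r)
    (hr : 1 ≤ r) (hrR : r ≤ R) {T : Set (Site 2)} (hT : ∀ v ∈ T, v 0 + R < k₁ ∨ k₁ + R < v 0) :
    μ.real (openCrossing S (rowIcc k₁ k₂) T) ≤ C * ((r : ℝ) / R) ^ α := by
  calc μ.real (openCrossing S (rowIcc k₁ k₂) T)
      ≤ μ.real (openCrossing univ ((· + (![k₁, 0] : Site 2)) '' (box 2 r : Set (Site 2)))
          ((· + (![k₁, 0] : Site 2)) '' ((box 2 R : Set (Site 2))ᶜ))) :=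
        measureReal_mono (interval_crossing_subset_escape S h hT) (measure_ne_top _ _)
    _ = μ.real {ω : BondConfig (Site 2) | ∃ x ∈ box 2 r, ∃ y ∉ box 2 R, ω ∈ openConnIn univ x y} :=
        measureReal_escape_shift _ _ _
    _ ≤ C * ((r : ℝ) / R) ^ α := hesc half (by simp) r R hr hrR

/-- **Interval-to-far-set bound** (source far): the same with the interval as the target. [folklore] -/
theorem measureReal_crossing_interval_le (S : Set (Site 2)) {k₁ k₂ : ℤ} {r R : ℕ} (h : k₂ - k₁ ≤ r)
    (hr : 1 ≤ r) (hrR : r ≤ R) {T : Set (Site 2)} (hT : ∀ v ∈ T, v 0 + R < k₁ ∨ k₁ + R < v 0) :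
    μ.real (openCrossing S T (rowIcc k₁ k₂)) ≤ C * ((r : ℝ) / R) ^ α := by
  rw [openCrossing_comm]
  exact measureReal_interval_crossing_le hesc S h hr hrR hT

end Escape

/-! ## §2 The lattice crossing function: monotonicity and one-endpoint moves

`Q(i,j,k,l) := P_{1/2}[[i,j]×{0} ↔ [k,l]×{0} in ℤ×ℕ]` (written out in full below; for the crux's arcs
`arcA a b n = rowIcc ⌊an⌋ ⌊bn⌋` definitionally). -/

/-- Splitting a boundary segment at `m`: `[p,q] ⊆ [p,m] ∪ [m+1,q]`. [folklore] -/
theorem rowIcc_subset_union (p q m : ℤ) : rowIcc p q ⊆ rowIcc p m ∪ rowIcc (m + 1) q := by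
  rintro v ⟨h1, h2, h3⟩
  by_cases h : v 0 ≤ m
  · exact Or.inl ⟨h1, h2, h⟩
  · exact Or.inr ⟨h1, by omega, h3⟩

/-- Splitting a boundary segment before `m`: `[p,q] ⊆ [p,m−1] ∪ [m,q]`. [folklore] -/
theorem rowIcc_subset_union' (p q m : ℤ) : rowIcc p q ⊆ rowIcc p (m - 1) ∪ rowIcc m q := by
  have h := rowIcc_subset_union p q (m - 1)
  rwa [sub_add_cancel] at h

/-- `Q` is nondecreasing in the right end `l` of the target arc. [folklore] -/
theorem crossing_mono_l (i j k : ℤ) {l l' : ℤ} (h : l ≤ l') :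
    μ.real (openCrossing halfPlane (rowIcc i j) (rowIcc k l)) ≤
      μ.real (openCrossing halfPlane (rowIcc i j) (rowIcc k l')) :=
  measureReal_mono (openCrossing_mono subset_rfl subset_rfl fun _ hv ↦ ⟨hv.1, hv.2.1, hv.2.2.trans h⟩)
    (measure_ne_top _ _)

/-- `Q` is nonincreasing in the left end `k` of the target arc. [folklore] -/
theorem crossing_mono_k (i j l : ℤ) {k k' : ℤ} (h : k' ≤ k) :
    μ.real (openCrossing halfPlane (rowIcc i j) (rowIcc k l)) ≤
      μ.real (openCrossing halfPlane (rowIcc i j) (rowIcc k' l)) :=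
  measureReal_mono (openCrossing_mono subset_rfl subset_rfl fun _ hv ↦ ⟨hv.1, h.trans hv.2.1, hv.2.2⟩)
    (measure_ne_top _ _)

/-- `Q` is nondecreasing in the right end `j` of the source arc. [folklore] -/
theorem crossing_mono_j (i k l : ℤ) {j j' : ℤ} (h : j ≤ j') :
    μ.real (openCrossing halfPlane (rowIcc i j) (rowIcc k l)) ≤
      μ.real (openCrossing halfPlane (rowIcc i j') (rowIcc k l)) :=
  measureReal_mono (openCrossing_mono subset_rfl (fun _ hv ↦ ⟨hv.1, hv.2.1, hv.2.2.trans h⟩) subset_rfl)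
    (measure_ne_top _ _)

/-- `Q` is nonincreasing in the left end `i` of the source arc. [folklore] -/
theorem crossing_mono_i (j k l : ℤ) {i i' : ℤ} (h : i' ≤ i) :
    μ.real (openCrossing halfPlane (rowIcc i j) (rowIcc k l)) ≤
      μ.real (openCrossing halfPlane (rowIcc i' j) (rowIcc k l)) :=
  measureReal_mono (openCrossing_mono subset_rfl (fun _ hv ↦ ⟨hv.1, h.trans hv.2.1, hv.2.2⟩) subset_rfl)
    (measure_ne_top _ _)

section Moves

variable {C α : ℝ}
  (hesc : ∀ p : unitInterval, (p : ℝ) ≤ 1 / 2 → ∀ r R : ℕ, 1 ≤ r → r ≤ R →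
    (bondPercolation (zdGraph 2) p).real
      {ω | ∃ x ∈ box 2 r, ∃ y ∉ box 2 R, ω ∈ openConnIn Set.univ x y} ≤ C * ((r : ℝ) / R) ^ α)
include hesc

/-- **Moving the right end of the target arc** by `≤ r` sites costs `≤ C (r/R)^α`, `R ≤` the gap
`l − j` between the new sites and the source arc. [folklore] -/
theorem le_move_l {i j k l l' : ℤ} {r R : ℕ} (hr : 1 ≤ r) (hrR : r ≤ R) (hd : l' - l ≤ r)
    (hR : (R : ℤ) ≤ l - j) :
    μ.real (openCrossing halfPlane (rowIcc i j) (rowIcc k l')) ≤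
      μ.real (openCrossing halfPlane (rowIcc i j) (rowIcc k l)) + C * ((r : ℝ) / R) ^ α := by
  have hsub : openCrossing halfPlane (rowIcc i j) (rowIcc k l') ⊆
      openCrossing halfPlane (rowIcc i j) (rowIcc k l) ∪
        openCrossing halfPlane (rowIcc i j) (rowIcc (l + 1) l') :=
    (openCrossing_mono subset_rfl subset_rfl (rowIcc_subset_union k l' l)).trans
      (openCrossing_union_right _ _ _ _).le
  have hfar : μ.real (openCrossing halfPlane (rowIcc i j) (rowIcc (l + 1) l')) ≤ C * ((r : ℝ) / R) ^ α :=
    measureReal_crossing_interval_le hesc halfPlane (by omega) hr hrR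
      fun v hv ↦ Or.inl (by have := hv.2.2; omega)
  calc μ.real (openCrossing halfPlane (rowIcc i j) (rowIcc k l'))
      ≤ μ.real (openCrossing halfPlane (rowIcc i j) (rowIcc k l) ∪
          openCrossing halfPlane (rowIcc i j) (rowIcc (l + 1) l')) := measureReal_mono hsub (measure_ne_top _ _)
    _ ≤ μ.real (openCrossing halfPlane (rowIcc i j) (rowIcc k l)) +
          μ.real (openCrossing halfPlane (rowIcc i j) (rowIcc (l + 1) l')) := measureReal_union_le _ _
    _ ≤ _ := by linarith

/-- **Moving the left end of the target arc** (shrinking it from `k` to `k'`) by `≤ r` sites costs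
`≤ C (r/R)^α`, `R <` the gap `k − j`. [folklore] -/
theorem le_move_k {i j k k' l : ℤ} {r R : ℕ} (hr : 1 ≤ r) (hrR : r ≤ R) (hd : k' - k ≤ r)
    (hR : (R : ℤ) ≤ k - j - 1) :
    μ.real (openCrossing halfPlane (rowIcc i j) (rowIcc k l)) ≤
      μ.real (openCrossing halfPlane (rowIcc i j) (rowIcc k' l)) + C * ((r : ℝ) / R) ^ α := by
  have hsub : openCrossing halfPlane (rowIcc i j) (rowIcc k l) ⊆
      openCrossing halfPlane (rowIcc i j) (rowIcc k (k' - 1)) ∪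
        openCrossing halfPlane (rowIcc i j) (rowIcc k' l) :=
    (openCrossing_mono subset_rfl subset_rfl (rowIcc_subset_union' k l k')).trans
      (openCrossing_union_right _ _ _ _).le
  have hfar : μ.real (openCrossing halfPlane (rowIcc i j) (rowIcc k (k' - 1))) ≤ C * ((r : ℝ) / R) ^ α :=
    measureReal_crossing_interval_le hesc halfPlane (by omega) hr hrR
      fun v hv ↦ Or.inl (by have := hv.2.2; omega)
  calc μ.real (openCrossing halfPlane (rowIcc i j) (rowIcc k l))
      ≤ μ.real (openCrossing halfPlane (rowIcc i j) (rowIcc k (k' - 1)) ∪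
          openCrossing halfPlane (rowIcc i j) (rowIcc k' l)) := measureReal_mono hsub (measure_ne_top _ _)
    _ ≤ μ.real (openCrossing halfPlane (rowIcc i j) (rowIcc k (k' - 1))) +
          μ.real (openCrossing halfPlane (rowIcc i j) (rowIcc k' l)) := measureReal_union_le _ _
    _ ≤ _ := by linarith

/-- **Moving the right end of the source arc** by `≤ r` sites costs `≤ C (r/R)^α`, `R ≤ k − j − 2`.
[folklore] -/
theorem le_move_j {i j j' k l : ℤ} {r R : ℕ} (hr : 1 ≤ r) (hrR : r ≤ R) (hd : j' - j ≤ r)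
    (hR : (R : ℤ) ≤ k - j - 2) :
    μ.real (openCrossing halfPlane (rowIcc i j') (rowIcc k l)) ≤
      μ.real (openCrossing halfPlane (rowIcc i j) (rowIcc k l)) + C * ((r : ℝ) / R) ^ α := by
  have hsplit : openCrossing halfPlane (rowIcc i j ∪ rowIcc (j + 1) j') (rowIcc k l) =
      openCrossing halfPlane (rowIcc i j) (rowIcc k l) ∪
        openCrossing halfPlane (rowIcc (j + 1) j') (rowIcc k l) := by
    rw [openCrossing_comm halfPlane (rowIcc i j ∪ rowIcc (j + 1) j'), openCrossing_union_right,
      openCrossing_comm halfPlane (rowIcc k l), openCrossing_comm halfPlane (rowIcc k l)]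
  have hsub : openCrossing halfPlane (rowIcc i j') (rowIcc k l) ⊆
      openCrossing halfPlane (rowIcc i j) (rowIcc k l) ∪
        openCrossing halfPlane (rowIcc (j + 1) j') (rowIcc k l) :=
    (openCrossing_mono subset_rfl (rowIcc_subset_union i j' j) subset_rfl).trans hsplit.le
  have hfar : μ.real (openCrossing halfPlane (rowIcc (j + 1) j') (rowIcc k l)) ≤ C * ((r : ℝ) / R) ^ α :=
    measureReal_interval_crossing_le hesc halfPlane (by omega) hr hrR
      fun v hv ↦ Or.inr (by have := hv.2.1; omega)
  calc μ.real (openCrossing halfPlane (rowIcc i j') (rowIcc k l))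
      ≤ μ.real (openCrossing halfPlane (rowIcc i j) (rowIcc k l) ∪
          openCrossing halfPlane (rowIcc (j + 1) j') (rowIcc k l)) := measureReal_mono hsub (measure_ne_top _ _)
    _ ≤ μ.real (openCrossing halfPlane (rowIcc i j) (rowIcc k l)) +
          μ.real (openCrossing halfPlane (rowIcc (j + 1) j') (rowIcc k l)) := measureReal_union_le _ _
    _ ≤ _ := by linarith

/-- **Moving the left end of the source arc** by `≤ r` sites costs `≤ C (r/R)^α`, `R ≤ k − i' − 1`.
[folklore] -/
theorem le_move_i {i i' j k l : ℤ} {r R : ℕ} (hr : 1 ≤ r) (hrR : r ≤ R) (hd : i - i' ≤ r)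
    (hR : (R : ℤ) ≤ k - i' - 1) :
    μ.real (openCrossing halfPlane (rowIcc i' j) (rowIcc k l)) ≤
      μ.real (openCrossing halfPlane (rowIcc i j) (rowIcc k l)) + C * ((r : ℝ) / R) ^ α := by
  have hsplit : openCrossing halfPlane (rowIcc i' (i - 1) ∪ rowIcc i j) (rowIcc k l) =
      openCrossing halfPlane (rowIcc i' (i - 1)) (rowIcc k l) ∪
        openCrossing halfPlane (rowIcc i j) (rowIcc k l) := by
    rw [openCrossing_comm halfPlane (rowIcc i' (i - 1) ∪ rowIcc i j), openCrossing_union_right,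
      openCrossing_comm halfPlane (rowIcc k l), openCrossing_comm halfPlane (rowIcc k l)]
  have hsub : openCrossing halfPlane (rowIcc i' j) (rowIcc k l) ⊆
      openCrossing halfPlane (rowIcc i' (i - 1)) (rowIcc k l) ∪
        openCrossing halfPlane (rowIcc i j) (rowIcc k l) :=
    (openCrossing_mono subset_rfl (rowIcc_subset_union' i' j i) subset_rfl).trans hsplit.le
  have hfar : μ.real (openCrossing halfPlane (rowIcc i' (i - 1)) (rowIcc k l)) ≤ C * ((r : ℝ) / R) ^ α :=
    measureReal_interval_crossing_le hesc halfPlane (by omega) hr hrR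
      fun v hv ↦ Or.inr (by have := hv.2.1; omega)
  calc μ.real (openCrossing halfPlane (rowIcc i' j) (rowIcc k l))
      ≤ μ.real (openCrossing halfPlane (rowIcc i' (i - 1)) (rowIcc k l) ∪
          openCrossing halfPlane (rowIcc i j) (rowIcc k l)) := measureReal_mono hsub (measure_ne_top _ _)
    _ ≤ μ.real (openCrossing halfPlane (rowIcc i' (i - 1)) (rowIcc k l)) +
          μ.real (openCrossing halfPlane (rowIcc i j) (rowIcc k l)) := measureReal_union_le _ _
    _ ≤ _ := by linarith

/-- **Joint monotone move.** If the source arc `[i,j]` grows to `[i',j']` and the target arc `[k,l]`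
to `[k',l']`, every endpoint moving by `≤ m` sites, and `m ≤ R ≤ (k' − j') − 2` (the new gap), then
`Q` increases, by at most `4 C (m/R)^α`. [folklore] -/
theorem move_le {i i' j j' k k' l l' : ℤ} {m R : ℕ} (hi : i' ≤ i) (hj : j ≤ j') (hk : k' ≤ k)
    (hl : l ≤ l') (hij : i ≤ j) (hkl : k ≤ l) (hm : 1 ≤ m) (hmR : m ≤ R) (hdi : i - i' ≤ m)
    (hdj : j' - j ≤ m) (hdk : k - k' ≤ m) (hdl : l' - l ≤ m) (hR : (R : ℤ) ≤ k' - j' - 2) :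
    μ.real (openCrossing halfPlane (rowIcc i j) (rowIcc k l)) ≤
        μ.real (openCrossing halfPlane (rowIcc i' j') (rowIcc k' l')) ∧
      μ.real (openCrossing halfPlane (rowIcc i' j') (rowIcc k' l')) ≤
        μ.real (openCrossing halfPlane (rowIcc i j) (rowIcc k l)) + 4 * (C * ((m : ℝ) / R) ^ α) := by
  constructor
  · calc μ.real (openCrossing halfPlane (rowIcc i j) (rowIcc k l))
        ≤ μ.real (openCrossing halfPlane (rowIcc i' j) (rowIcc k l)) := crossing_mono_i j k l hi
      _ ≤ μ.real (openCrossing halfPlane (rowIcc i' j') (rowIcc k l)) := crossing_mono_j i' k l hj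
      _ ≤ μ.real (openCrossing halfPlane (rowIcc i' j') (rowIcc k' l)) := crossing_mono_k i' j' l hk
      _ ≤ μ.real (openCrossing halfPlane (rowIcc i' j') (rowIcc k' l')) := crossing_mono_l i' j' k' hl
  · have h1 := le_move_l hesc (i := i') (j := j') (k := k') (l := l) (l' := l') hm hmR hdl (by omega)
    have h2 := le_move_k hesc (i := i') (j := j') (k := k') (k' := k) (l := l) hm hmR hdk (by omega)
    have h3 := le_move_j hesc (i := i') (j := j) (j' := j') (k := k) (l := l) hm hmR hdj (by omega)
    have h4 := le_move_i hesc (i := i) (i' := i') (j := j) (k := k) (l := l) hm hmR hdi (by omega)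
    linarith

end Moves

end Subseq

/-- **Registered extra stub of line `Sketch` (lead c2-0): the joint lattice move bound.**  For any
admissible RSW escape constants `C, α` (tree `exists_real_boxToFar_le_rpow_of_le_half`): growing the
source arc `[i,j]×{0}` to `[i',j']×{0}` and the target arc `[k,l]×{0}` to `[k',l']×{0}` in `ℤ×ℕ`,
every endpoint moving by `≤ m` sites, `1 ≤ m ≤ R ≤ (k'−j') − 2`, increases the half-plane crossing
probability, by at most `4C(m/R)^α`. [folklore] -/
theorem stub_latticeMoveBound :
    ∀ (C α : ℝ), (∀ p : unitInterval, (p : ℝ) ≤ 1 / 2 → ∀ r R : ℕ, 1 ≤ r → r ≤ R →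
      (bondPercolation (zdGraph 2) p).real
        {ω | ∃ x ∈ box 2 r, ∃ y ∉ box 2 R, ω ∈ openConnIn Set.univ x y} ≤ C * ((r : ℝ) / R) ^ α) →
    ∀ (i i' j j' k k' l l' : ℤ) (m R : ℕ), i' ≤ i → j ≤ j' → k' ≤ k → l ≤ l' → i ≤ j → k ≤ l →
      1 ≤ m → m ≤ R → i - i' ≤ m → j' - j ≤ m → k - k' ≤ m → l' - l ≤ m → (R : ℤ) ≤ k' - j' - 2 →
      μ.real (openCrossing halfPlane (rowIcc i j) (rowIcc k l)) ≤
          μ.real (openCrossing halfPlane (rowIcc i' j') (rowIcc k' l')) ∧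
        μ.real (openCrossing halfPlane (rowIcc i' j') (rowIcc k' l')) ≤
          μ.real (openCrossing halfPlane (rowIcc i j) (rowIcc k l)) + 4 * (C * ((m : ℝ) / R) ^ α) :=
  fun _ _ hesc _ _ _ _ _ _ _ _ _ _ hi hj hk hl hij hkl hm hmR hdi hdj hdk hdl hR ↦
    Subseq.move_le hesc hi hj hk hl hij hkl hm hmR hdi hdj hdk hdl hR

end Summit.CriticalPhenomena.CardyFormulaZ2.Cruxes.HalfPlaneMarkDensityLaw.SketchLine

end
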